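import Summits.ResolutionOfSingularities.ResolutionOfSingularities.Theorems.PurelyInseparableDim4ChartAtlasSNCFarRepair
import HarnessLib

/-!
# Purely inseparable four-folds `z^p + F(x₁, …, x₄)`: bookkeeping for the chart AFTER the far-resonance repair — partial derivatives and prime-ideal
# facts of the product quadrics `y_j·y_m + a`, the resonant strict transforms `y_k·(y_j - c') + b_k` and the cubics (S3-N2 far repair; typ-2 g6)

[OURS · counted 0] (D-0157 DOOR 2; DR-157-C). On the `y_j`-chart of the repair blow-up of `Σ = V(y_0, y_T, y_j)` (p707037's readings) the transformed
boundary consists of hyperplanes, PRODUCT QUADRICS `PQ_{m,a} = y_j·y_m + a` (`m ∈ {0} ∪ T⁺`, `a ≠ 0`: the old hyperplanes missing `Σ`), the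
RESONANT STRICT TRANSFORMS `g_k = y_k·(y_j - c') + b_k`, the CUBICS `CU_k = (y_j·y_k + b_k)·y_j - c'·y_j·y_k + e_k` (non-resonant far members,
`k ∈ T`) and the untouched `TQ_m` (`m ∉ T`, p706678 §1). This file is the algebra the indexed Jacobian engine (p707152) consumes there, PROVED
(no `sorry`, no new axiom): the partial derivatives of `PQ`, `g`, `CU` and the prime-ideal facts — units on each member (`X_j_not_mem_of_pquadric_mem`,
`X_sub_C_not_mem_of_resonant_mem`, `X_j_mul_not_mem_of_cubic_mem`), what an ACTIVE cubic (`y_k ∈ 𝔭`) forces (`cubic_active`: `b_k·y_j + e_k ∈ 𝔭`,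
`b_k ≠ 0`), the equal-height identity of two active cubics (`height_eq_of_cubic_mem_of_cubic_mem`: `e_k·b_k' = e_k'·b_k`), the height of a
hyperplane `y_j + a` through an active cubic (`height_eq_of_X_j_add_C_mem`: `e_k = a·b_k`), and the incidences that never happen
(`PQ_{k,b_k}` with `g_k` or `CU_k`; `g_k` with `CU_k`; `y_k` with `PQ_{k,a}` / `g_k`). Nothing here is a statement about resolution of singularities in
dimension ≥ 4 / characteristic `p` (NOT proved anywhere in this programme). bears_on: LADDER-RESOLUTION:D157-DOOR2 (res-dim4-pi). Supports
stmt-ResolutionOfSingularities-16155 (helper, S3-N2 far repair).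
-/

-- every declaration of this summit lives under `Summit.ResolutionOfSingularities.ResolutionOfSingularities`
-- (summit = problem), which the duplicate-namespace linter flags; house convention (cf. the Target file).
set_option linter.dupNamespace false

noncomputable section

open MvPolynomial CategoryTheory AlgebraicGeometry Opposite TopologicalSpace
open AlgebraicGeometry.Scheme.IdealSheafData (ofIdealTop)

namespace Summit.ResolutionOfSingularities.ResolutionOfSingularities.Theorems.PIDim4

open Literature.AlgebraicGeometry.Resolution
open Literature.AlgebraicGeometry.Resolution.AffinePointBlowup (P A γ coord Wtop ξ)

namespace ChartDictionary

variable {K : Type} [Field K] {j : Fin 4} {b e : Fin 4 → K} {c' : K}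

/-! ## §1 Product quadrics `PQ_{m,a} = y_j·y_m + a` -/

/-- `∂(y_j·y_m + a)/∂y_m = y_j` (`m ≠ j⁺`). -/
theorem pderiv_pquadric_self {m : Fin (4 + 1)} (hmj : m ≠ j.succ) (a : K) : pderiv m (X j.succ * X m + C a : A 4 K) = X j.succ := by
  classical
  rw [map_add, pderiv_C, add_zero, Derivation.leibniz, smul_eq_mul, smul_eq_mul, pderiv_X_self, mul_one, pderiv_X_of_ne hmj.symm, mul_zero,
    add_zero]

/-- `∂(y_j·y_m + a)/∂y_j = y_m` (`m ≠ j⁺`). -/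
theorem pderiv_pquadric_j {m : Fin (4 + 1)} (hmj : m ≠ j.succ) (a : K) : pderiv j.succ (X j.succ * X m + C a : A 4 K) = X m := by
  classical
  rw [map_add, pderiv_C, add_zero, Derivation.leibniz, smul_eq_mul, smul_eq_mul, pderiv_X_of_ne hmj, mul_zero, zero_add, pderiv_X_self, mul_one]

/-- `∂(y_j·y_m + a)/∂y_o = 0` for `o ≠ m, j⁺`. -/
theorem pderiv_pquadric_of_ne {m o : Fin (4 + 1)} (hom : o ≠ m) (hoj : o ≠ j.succ) (a : K) : pderiv o (X j.succ * X m + C a : A 4 K) = 0 := by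
  classical
  rw [map_add, pderiv_C, add_zero, Derivation.leibniz, smul_eq_mul, smul_eq_mul, pderiv_X_of_ne hom.symm, pderiv_X_of_ne hoj.symm, mul_zero,
    mul_zero, add_zero]

/-- On `V(PQ_{m,a})`, `a ≠ 0`: `y_j ∉ 𝔭` and `y_m ∉ 𝔭`. -/
theorem X_not_mem_of_pquadric_mem (x : P 4 K) {m : Fin (4 + 1)} {a : K} (ha : a ≠ 0) (hQ : (X j.succ * X m + C a : A 4 K) ∈ x.asIdeal) :
    (X j.succ : A 4 K) ∉ x.asIdeal ∧ (X m : A 4 K) ∉ x.asIdeal := by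
  constructor
  · intro hX
    have h := x.asIdeal.sub_mem hQ (x.asIdeal.mul_mem_right (X m) hX)
    rw [add_sub_cancel_left, C_mem_asIdeal_iff] at h
    exact ha h
  · intro hX
    have h := x.asIdeal.sub_mem hQ (x.asIdeal.mul_mem_left (X j.succ) hX)
    rw [add_sub_cancel_left, C_mem_asIdeal_iff] at h
    exact ha h

/-- Two product quadrics of one index through one point are equal. -/
theorem pquadric_const_eq_of_mem_of_mem (x : P 4 K) {m : Fin (4 + 1)} {a a' : K} (ha : (X j.succ * X m + C a : A 4 K) ∈ x.asIdeal)
    (ha' : (X j.succ * X m + C a' : A 4 K) ∈ x.asIdeal) : a = a' := by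
  have h := x.asIdeal.sub_mem ha ha'
  rw [add_sub_add_left_eq_sub, ← C_sub, C_mem_asIdeal_iff, sub_eq_zero] at h
  exact h

/-! ## §2 Resonant strict transforms `g_k = y_k·(y_j - c') + b_k` -/

/-- `∂g_k/∂y_k = y_j - c'` (`k ≠ j`). -/
theorem pderiv_resonant_self {k : Fin 4} (hkj : k ≠ j) : pderiv k.succ (X k.succ * (X j.succ - C c') + C (b k) : A 4 K) = X j.succ - C c' := by
  classical
  rw [map_add, pderiv_C, add_zero, Derivation.leibniz, smul_eq_mul, smul_eq_mul, map_sub, pderiv_C, sub_zero,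
    pderiv_X_of_ne (fun h => hkj (Fin.succ_injective _ h).symm), mul_zero, zero_add, pderiv_X_self, mul_one]

/-- `∂g_k/∂y_j = y_k` (`k ≠ j`). -/
theorem pderiv_resonant_j {k : Fin 4} (hkj : k ≠ j) : pderiv j.succ (X k.succ * (X j.succ - C c') + C (b k) : A 4 K) = X k.succ := by
  classical
  rw [map_add, pderiv_C, add_zero, Derivation.leibniz, smul_eq_mul, smul_eq_mul, map_sub, pderiv_C, sub_zero, pderiv_X_self, mul_one,
    pderiv_X_of_ne (fun h => hkj (Fin.succ_injective _ h)), mul_zero, add_zero]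

/-- `∂g_k/∂y_o = 0` for `o ≠ k⁺, j⁺`. -/
theorem pderiv_resonant_of_ne {k : Fin 4} {o : Fin (4 + 1)} (hok : o ≠ k.succ) (hoj : o ≠ j.succ) :
    pderiv o (X k.succ * (X j.succ - C c') + C (b k) : A 4 K) = 0 := by
  classical
  rw [map_add, pderiv_C, add_zero, Derivation.leibniz, smul_eq_mul, smul_eq_mul, map_sub, pderiv_C, sub_zero, pderiv_X_of_ne hoj.symm,
    mul_zero, zero_add, pderiv_X_of_ne hok.symm, mul_zero]

/-- On `V(g_k)`, `b_k ≠ 0`: `y_j - c' ∉ 𝔭` and `y_k ∉ 𝔭`. -/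
theorem not_mem_of_resonant_mem (x : P 4 K) {k : Fin 4} (hbk : b k ≠ 0) (hg : (X k.succ * (X j.succ - C c') + C (b k) : A 4 K) ∈ x.asIdeal) :
    (X j.succ - C c' : A 4 K) ∉ x.asIdeal ∧ (X k.succ : A 4 K) ∉ x.asIdeal := by
  constructor
  · intro hX
    have h := x.asIdeal.sub_mem hg (x.asIdeal.mul_mem_left (X k.succ) hX)
    rw [add_sub_cancel_left, C_mem_asIdeal_iff] at h
    exact hbk h
  · intro hX
    have h := x.asIdeal.sub_mem hg (x.asIdeal.mul_mem_right (X j.succ - C c') hX)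
    rw [add_sub_cancel_left, C_mem_asIdeal_iff] at h
    exact hbk h

/-- `PQ_{k⁺,b_k}` and `g_k` never meet (`b_k ≠ 0`, `c' ≠ 0`): their difference is `c'·y_k`. -/
theorem not_mem_of_resonant_mem_of_pquadric_mem (x : P 4 K) {k : Fin 4} (hbk : b k ≠ 0) (hc' : c' ≠ 0)
    (hg : (X k.succ * (X j.succ - C c') + C (b k) : A 4 K) ∈ x.asIdeal) : (X j.succ * X k.succ + C (b k) : A 4 K) ∉ x.asIdeal := by
  intro hQ
  have h := x.asIdeal.sub_mem hQ hg
  have e1 : (X j.succ * X k.succ + C (b k) - (X k.succ * (X j.succ - C c') + C (b k)) : A 4 K) = C c' * X k.succ := by ring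
  rw [e1] at h
  rcases x.2.mem_or_mem h with h1 | h1
  · exact hc' ((C_mem_asIdeal_iff x _).mp h1)
  · exact (not_mem_of_resonant_mem x hbk hg).2 h1

/-! ## §3 Cubics `CU_k = (y_j·y_k + b_k)·y_j - c'·y_j·y_k + e_k` -/

/-- `∂CU_k/∂y_k = y_j·(y_j - c')` (`k ≠ j`). -/
theorem pderiv_cubic_self {k : Fin 4} (hkj : k ≠ j) :
    pderiv k.succ ((X j.succ * X k.succ + C (b k)) * X j.succ - C c' * (X j.succ * X k.succ) + C (e k) : A 4 K) = X j.succ * (X j.succ - C c') := by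
  classical
  have hjk : (j.succ : Fin (4 + 1)) ≠ k.succ := fun h => hkj (Fin.succ_injective _ h).symm
  simp only [map_add, map_sub, pderiv_C, Derivation.leibniz, smul_eq_mul, pderiv_X_self, pderiv_X_of_ne hjk]
  ring

/-- `∂CU_k/∂y_j = 2·y_j·y_k + b_k - c'·y_k` (`k ≠ j`). -/
theorem pderiv_cubic_j {k : Fin 4} (hkj : k ≠ j) :
    pderiv j.succ ((X j.succ * X k.succ + C (b k)) * X j.succ - C c' * (X j.succ * X k.succ) + C (e k) : A 4 K) =
      2 * X j.succ * X k.succ + C (b k) - C c' * X k.succ := by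
  classical
  have hkj' : (k.succ : Fin (4 + 1)) ≠ j.succ := fun h => hkj (Fin.succ_injective _ h)
  simp only [map_add, map_sub, pderiv_C, Derivation.leibniz, smul_eq_mul, pderiv_X_self, pderiv_X_of_ne hkj']
  ring

/-- `∂CU_k/∂y_o = 0` for `o ≠ k⁺, j⁺`. -/
theorem pderiv_cubic_of_ne {k : Fin 4} {o : Fin (4 + 1)} (hok : o ≠ k.succ) (hoj : o ≠ j.succ) :
    pderiv o ((X j.succ * X k.succ + C (b k)) * X j.succ - C c' * (X j.succ * X k.succ) + C (e k) : A 4 K) = 0 := by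
  classical
  simp only [map_add, map_sub, pderiv_C, Derivation.leibniz, smul_eq_mul, pderiv_X_of_ne hok.symm, pderiv_X_of_ne hoj.symm]
  ring

/-- On `V(CU_k)` (`e_k ≠ 0`, `d_k = e_k + b_k·c' ≠ 0`): `y_j ∉ 𝔭` and `y_j - c' ∉ 𝔭`, hence `y_j·(y_j - c') ∉ 𝔭`. -/
theorem X_j_mul_not_mem_of_cubic_mem (x : P 4 K) {k : Fin 4} (hek : e k ≠ 0) (hd : e k + b k * c' ≠ 0)
    (hQ : ((X j.succ * X k.succ + C (b k)) * X j.succ - C c' * (X j.succ * X k.succ) + C (e k) : A 4 K) ∈ x.asIdeal) :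
    (X j.succ * (X j.succ - C c') : A 4 K) ∉ x.asIdeal := by
  intro h
  rcases x.2.mem_or_mem h with hXj | hXj
  · have h1 := x.asIdeal.sub_mem hQ (x.asIdeal.mul_mem_left ((X j.succ * X k.succ + C (b k)) - C c' * X k.succ) hXj)
    have e1 : ((X j.succ * X k.succ + C (b k)) * X j.succ - C c' * (X j.succ * X k.succ) + C (e k) -
        ((X j.succ * X k.succ + C (b k)) - C c' * X k.succ) * X j.succ : A 4 K) = C (e k) := by ring
    rw [e1, C_mem_asIdeal_iff] at h1
    exact hek h1
  · have h1 := x.asIdeal.sub_mem hQ (x.asIdeal.mul_mem_left (X j.succ * X k.succ + C (b k)) hXj)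
    have e1 : ((X j.succ * X k.succ + C (b k)) * X j.succ - C c' * (X j.succ * X k.succ) + C (e k) -
        (X j.succ * X k.succ + C (b k)) * (X j.succ - C c') : A 4 K) = C (e k + b k * c') := by
      simp only [C_add, C_mul]; ring
    rw [e1, C_mem_asIdeal_iff] at h1
    exact hd h1

/-- **An ACTIVE cubic** (`y_k ∈ 𝔭`): `b_k·y_j + e_k ∈ 𝔭`, `b_k ≠ 0`, and `∂CU_k/∂y_j ∉ 𝔭`. -/
theorem cubic_active (x : P 4 K) {k : Fin 4} (hek : e k ≠ 0)
    (hQ : ((X j.succ * X k.succ + C (b k)) * X j.succ - C c' * (X j.succ * X k.succ) + C (e k) : A 4 K) ∈ x.asIdeal)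
    (hXk : (X k.succ : A 4 K) ∈ x.asIdeal) :
    (C (b k) * X j.succ + C (e k) : A 4 K) ∈ x.asIdeal ∧ b k ≠ 0 ∧ (2 * X j.succ * X k.succ + C (b k) - C c' * X k.succ : A 4 K) ∉ x.asIdeal := by
  have h : (C (b k) * X j.succ + C (e k) : A 4 K) ∈ x.asIdeal := by
    have h1 := x.asIdeal.sub_mem hQ (x.asIdeal.mul_mem_left (X j.succ * X j.succ - C c' * X j.succ) hXk)
    have e1 : ((X j.succ * X k.succ + C (b k)) * X j.succ - C c' * (X j.succ * X k.succ) + C (e k) -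
        (X j.succ * X j.succ - C c' * X j.succ) * X k.succ : A 4 K) = C (b k) * X j.succ + C (e k) := by ring
    rwa [e1] at h1
  have hbk : b k ≠ 0 := fun hb => hek (by rw [hb, C_0, zero_mul, zero_add, C_mem_asIdeal_iff] at h; exact h)
  refine ⟨h, hbk, fun hmem => hbk ?_⟩
  have h2 := x.asIdeal.sub_mem hmem (x.asIdeal.mul_mem_left (2 * X j.succ - C c') hXk)
  have e2 : (2 * X j.succ * X k.succ + C (b k) - C c' * X k.succ - (2 * X j.succ - C c') * X k.succ : A 4 K) = C (b k) := by ring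
  rw [e2, C_mem_asIdeal_iff] at h2
  exact h2

/-- **Equal heights of two active cubics**: `e_k·b_k' = e_k'·b_k`. -/
theorem height_eq_of_cubic_mem_of_cubic_mem (x : P 4 K) {k k' : Fin 4} (hek : e k ≠ 0) (hek' : e k' ≠ 0)
    (hQ : ((X j.succ * X k.succ + C (b k)) * X j.succ - C c' * (X j.succ * X k.succ) + C (e k) : A 4 K) ∈ x.asIdeal)
    (hXk : (X k.succ : A 4 K) ∈ x.asIdeal)
    (hQ' : ((X j.succ * X k'.succ + C (b k')) * X j.succ - C c' * (X j.succ * X k'.succ) + C (e k') : A 4 K) ∈ x.asIdeal)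
    (hXk' : (X k'.succ : A 4 K) ∈ x.asIdeal) : e k * b k' = e k' * b k := by
  obtain ⟨h, -, -⟩ := cubic_active x hek hQ hXk
  obtain ⟨h', -, -⟩ := cubic_active x hek' hQ' hXk'
  have h1 := x.asIdeal.sub_mem (x.asIdeal.mul_mem_left (C (b k')) h) (x.asIdeal.mul_mem_left (C (b k)) h')
  have e1 : (C (b k') * (C (b k) * X j.succ + C (e k)) - C (b k) * (C (b k') * X j.succ + C (e k')) : A 4 K) = C (e k * b k' - e k' * b k) := by
    simp only [C_sub, C_mul]; ring
  rw [e1, C_mem_asIdeal_iff, sub_eq_zero] at h1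
  exact h1

/-- **The height of a hyperplane `y_j + a` through an active cubic**: `e_k = a·b_k`. -/
theorem height_eq_of_X_j_add_C_mem_cubic (x : P 4 K) {k : Fin 4} (hek : e k ≠ 0)
    (hQ : ((X j.succ * X k.succ + C (b k)) * X j.succ - C c' * (X j.succ * X k.succ) + C (e k) : A 4 K) ∈ x.asIdeal)
    (hXk : (X k.succ : A 4 K) ∈ x.asIdeal) {a : K} (ha : (X j.succ + C a : A 4 K) ∈ x.asIdeal) : e k = a * b k := by
  obtain ⟨h, -, -⟩ := cubic_active x hek hQ hXk
  have h1 := x.asIdeal.sub_mem h (x.asIdeal.mul_mem_left (C (b k)) ha)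
  have e1 : (C (b k) * X j.succ + C (e k) - C (b k) * (X j.succ + C a) : A 4 K) = C (e k - a * b k) := by
    simp only [C_sub, C_mul]; ring
  rw [e1, C_mem_asIdeal_iff, sub_eq_zero] at h1
  exact h1

/-- `PQ_{k⁺,a}` and an ACTIVE cubic never meet (`a ≠ 0`): `y_k ∈ 𝔭` kills the product quadric's variable part. -/
theorem pquadric_not_mem_of_X_mem (x : P 4 K) {k : Fin 4} {a : K} (ha : a ≠ 0) (hXk : (X k.succ : A 4 K) ∈ x.asIdeal) :
    (X j.succ * X k.succ + C a : A 4 K) ∉ x.asIdeal :=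
  fun h => (X_not_mem_of_pquadric_mem x ha h).2 hXk

/-- `PQ_{k⁺,b_k}` and `CU_k` never meet: modulo `PQ_{k⁺,b_k}` the cubic is the unit `d_k = e_k + b_k·c'`. -/
theorem cubic_not_mem_of_pquadric_mem (x : P 4 K) {k : Fin 4} (hd : e k + b k * c' ≠ 0) (hQ : (X j.succ * X k.succ + C (b k) : A 4 K) ∈ x.asIdeal) :
    ((X j.succ * X k.succ + C (b k)) * X j.succ - C c' * (X j.succ * X k.succ) + C (e k) : A 4 K) ∉ x.asIdeal := by
  intro hC
  have h := x.asIdeal.sub_mem hC (x.asIdeal.mul_mem_right (X j.succ - C c') hQ)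
  have e1 : ((X j.succ * X k.succ + C (b k)) * X j.succ - C c' * (X j.succ * X k.succ) + C (e k) -
      (X j.succ * X k.succ + C (b k)) * (X j.succ - C c') : A 4 K) = C (e k + b k * c') := by
    simp only [C_add, C_mul]; ring
  rw [e1, C_mem_asIdeal_iff] at h
  exact hd h

/-- `g_k` and `CU_k` never meet (`e_k ≠ 0`): `CU_k = y_j·g_k + e_k`. -/
theorem cubic_not_mem_of_resonant_mem (x : P 4 K) {k : Fin 4} (hek : e k ≠ 0) (hg : (X k.succ * (X j.succ - C c') + C (b k) : A 4 K) ∈ x.asIdeal) :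
    ((X j.succ * X k.succ + C (b k)) * X j.succ - C c' * (X j.succ * X k.succ) + C (e k) : A 4 K) ∉ x.asIdeal := by
  intro hC
  have h := x.asIdeal.sub_mem hC (x.asIdeal.mul_mem_left (X j.succ) hg)
  have e1 : ((X j.succ * X k.succ + C (b k)) * X j.succ - C c' * (X j.succ * X k.succ) + C (e k) - X j.succ * (X k.succ * (X j.succ - C c') + C (b k)) :
      A 4 K) = C (e k) := by ring
  rw [e1, C_mem_asIdeal_iff] at h
  exact hek h

end ChartDictionary

end Summit.ResolutionOfSingularities.ResolutionOfSingularities.Theorems.PIDim4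

end
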